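import Summits.QuantumFields.YangMills.Theses.TransverseWardBL
import Summits.QuantumFields.YangMills.Theorems.SoloInformedU1HelicityTorus
import Summits.QuantumFields.YangMills.Theorems.U1DipoleHelicityWardReal
import Literature.MathematicalPhysics.QuantumFieldTheory.U1GinibreComparison
import Literature.MathematicalPhysics.QuantumFieldTheory.LatticeGaugeProofs
import HarnessLib

/-!
# Route `TransverseWardBL`, support `WardPinning` (stmt-QuantumFields-22930): the Ward lever

Wilson `U(1)₄` on the torus `(ℤ/(M+1))⁴`, `β > 0` (in fact any `β`), with `f_w(U) = ∑_p w(p) sin θ_p(U)` and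
`m = torusMeanPlaq β M = ⟨cos θ_p⟩`: for every real 1-cochain `α` and every 2-cochain `u` CO-CLOSED in the sense
`∑_p u(p)·(dδ_e)(p) = 0` for every edge `e`,

  `β·⟨f_(dα+u)²⟩ = m·|dα|² + β·⟨f_u²⟩`.

Proof (the Ward lever of Guth / Fröhlich–Spencer): the real-charge Ward identity on the torus
(`U1DipoleHelicity.u1_torus_ward_identity_real`, Haar invariance under `θ_e ↦ θ_e + α_e t`) with charge `c = α`, whose
action derivative is `X_αS = f_(dα)`:
* with `F = f_(dα)`: `β⟨f_(dα)²⟩ = ∑_p (dα)_p²⟨cos θ_p⟩ = m·|dα|²` (`ward_ractionFlowDeriv` + all plaquettes have the same mean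
  cosine, `wilsonExpectation_plaquette_re_eq`);
* with `F = f_u`: `β⟨f_u·f_(dα)⟩ = ∑_p u_p (dα)_p ⟨cos θ_p⟩ = m·∑_p u_p (dα)_p = 0`, because `dα = ∑_e α_e dδ_e` (linearity of
  `td₁`) and `u` is orthogonal to every `dδ_e`;
* expand the square and integrate (bounded continuous observables, probability state).

Free-hands width seat `ym-t4-w11` (cell ym-fleet) for planner ym-idea-4 g9 (LINE g9-A).  THEOREMS ONLY; an identity for the abelian
comparison theory — nothing about the Yang–Mills mass gap is proved.

References: A. Guth, Phys. Rev. D **21** (1980) 2291 [Guth1980]; J. Fröhlich, T. Spencer, Comm. Math. Phys. **83** (1982) 411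
[FrohlichSpencer1982].
-/

set_option autoImplicit false

noncomputable section

open MeasureTheory Filter Topology Finset
open scoped BigOperators
open Literature.MathematicalPhysics.QuantumFieldTheory Literature.MathematicalPhysics.QuantumLattice
open Literature.Probability.LatticeModels (Torus.proj)
open Summit.QuantumFields.YangMills.Theorems.U1Helicity (torusMeanPlaq)
open Summit.QuantumFields.YangMills.Theorems.U1DipoleHelicity

namespace Summit.QuantumFields.YangMills.Theorems.TransverseWardBL

variable {M : ℕ}

/-! ## §1 The 1-cochain `α` as a real edge charge -/

/-- The action derivative along the flow of charge `α` is `f_(dα) = ∑_p (dα)_p sin θ_p`. [folklore] -/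
theorem ractionFlowDeriv_cochain (α : Site 4 (M + 1) → Fin 4 → ℝ) (U : GaugeConfig 4 (M + 1) Circle) :
    ractionFlowDeriv (fun e : Edge 4 (M + 1) => α e.1 e.2) U =
      ∑ p : Plaquette 4 (M + 1), LatticeForm.res (LatticeForm.td₁ α) p *
        ((plaquetteHolonomy U p.1 p.2.1.1 p.2.1.2 : Circle) : ℂ).im := rfl

/-- Linearity of the coboundary on the edge basis: `(dα)_p = ∑_e α_e (dδ_e)_p`. [folklore] -/
theorem res_td₁_eq_sum_basis (α : Site 4 (M + 1) → Fin 4 → ℝ) (p : Plaquette 4 (M + 1)) :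
    LatticeForm.res (LatticeForm.td₁ α) p =
      ∑ e : Edge 4 (M + 1), α e.1 e.2 *
        LatticeForm.res (LatticeForm.td₁ (fun (y : Site 4 (M + 1)) (k : Fin 4) => if y = e.1 ∧ k = e.2 then (1 : ℝ) else 0)) p := by
  classical
  have hδ : ∀ (y : Site 4 (M + 1)) (k : Fin 4),
      α y k = ∑ e : Edge 4 (M + 1), α e.1 e.2 * (if y = e.1 ∧ k = e.2 then (1 : ℝ) else 0) := by
    intro y k
    rw [Finset.sum_eq_single (y, k)]
    · simp
    · intro e _ he
      rw [if_neg, mul_zero]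
      rintro ⟨h1, h2⟩
      exact he (Prod.ext h1.symm h2.symm)
    · intro h; exact absurd (Finset.mem_univ _) h
  simp only [LatticeForm.res, LatticeForm.td₁]
  rw [hδ p.1 p.2.1.1, hδ (p.1 + LatticeForm.te p.2.1.1) p.2.1.2, hδ (p.1 + LatticeForm.te p.2.1.2) p.2.1.1, hδ p.1 p.2.1.2]
  simp only [mul_add, mul_sub, Finset.sum_add_distrib, Finset.sum_sub_distrib]

/-- A 2-cochain orthogonal to every `dδ_e` is orthogonal to every coboundary: `∑_p u_p (dα)_p = 0`. [folklore] -/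
theorem sum_mul_res_td₁_eq_zero {u : Plaquette 4 (M + 1) → ℝ}
    (hu : ∀ e : Edge 4 (M + 1), ∑ p : Plaquette 4 (M + 1), u p *
      LatticeForm.res (LatticeForm.td₁ (fun (y : Site 4 (M + 1)) (k : Fin 4) => if y = e.1 ∧ k = e.2 then (1 : ℝ) else 0)) p = 0)
    (α : Site 4 (M + 1) → Fin 4 → ℝ) :
    ∑ p : Plaquette 4 (M + 1), u p * LatticeForm.res (LatticeForm.td₁ α) p = 0 := by
  simp_rw [res_td₁_eq_sum_basis α, Finset.mul_sum]
  rw [Finset.sum_comm]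
  simp_rw [mul_left_comm (u _) (α _ _), ← Finset.mul_sum, hu, mul_zero, Finset.sum_const_zero]

/-! ## §2 Expectations of weighted plaquette cosines -/

/-- Every plaquette of the torus has mean cosine `torusMeanPlaq β M`. [folklore] -/
theorem wilsonExpectation_plaquette_re_eq_torusMeanPlaq (β : ℝ) (M : ℕ) (q : Plaquette 4 (M + 1)) :
    wilsonExpectation (L := M + 1) u1Rep β
        (fun U : GaugeConfig 4 (M + 1) Circle => ((plaquetteHolonomy U q.1 q.2.1.1 q.2.1.2 : Circle) : ℂ).re) =
      torusMeanPlaq β M := by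
  rw [wilsonExpectation_plaquette_re_eq β q (0 : Site 4 (M + 1)) (i := 0) (j := 1) (by decide)]
  unfold torusMeanPlaq
  congr 1
  funext U
  simp only [toTorusObservable_apply, plaquette_torusLift, torusProj_zero]

/-- `⟨∑_q w_q cos θ_q⟩ = (∑_q w_q)·torusMeanPlaq β M`. [folklore] -/
theorem wilsonExpectation_sum_mul_re (β : ℝ) (M : ℕ) (w : Plaquette 4 (M + 1) → ℝ) :
    wilsonExpectation (L := M + 1) u1Rep β (fun U : GaugeConfig 4 (M + 1) Circle =>
        ∑ q : Plaquette 4 (M + 1), w q * ((plaquetteHolonomy U q.1 q.2.1.1 q.2.1.2 : Circle) : ℂ).re) =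
      (∑ q : Plaquette 4 (M + 1), w q) * torusMeanPlaq β M := by
  have h : ∀ q : Plaquette 4 (M + 1),
      wilsonExpectation (L := M + 1) u1Rep β (fun U : GaugeConfig 4 (M + 1) Circle =>
          w q * ((plaquetteHolonomy U q.1 q.2.1.1 q.2.1.2 : Circle) : ℂ).re) = w q * torusMeanPlaq β M := by
    intro q
    rw [← wilsonExpectation_plaquette_re_eq_torusMeanPlaq β M q]
    unfold wilsonExpectation
    exact integral_const_mul _ _
  unfold wilsonExpectation at h ⊢
  rw [integral_finsetSum _ fun q _ =>
    (integrable_wilson_of_continuous β (continuous_plaquette_re q.1 q.2.1.1 q.2.1.2)).const_mul (w q), Finset.sum_mul]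
  exact Finset.sum_congr rfl fun q _ => h q

/-! ## §3 The two Ward identities -/

/-- **Exact sector pinned at the mean plaquette**: `β⟨f_(dα)²⟩ = torusMeanPlaq β M · |dα|²`. [cite: Guth1980, §III] -/
theorem exact_sector (β : ℝ) (M : ℕ) (α : Site 4 (M + 1) → Fin 4 → ℝ) :
    β * wilsonExpectation (L := M + 1) u1Rep β (fun U : GaugeConfig 4 (M + 1) Circle =>
        (∑ p : Plaquette 4 (M + 1), LatticeForm.res (LatticeForm.td₁ α) p *
          ((plaquetteHolonomy U p.1 p.2.1.1 p.2.1.2 : Circle) : ℂ).im) ^ 2) =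
      torusMeanPlaq β M * ∑ p : Plaquette 4 (M + 1), (LatticeForm.res (LatticeForm.td₁ α) p) ^ 2 := by
  have h := ward_ractionFlowDeriv (d := 4) (L := M + 1) (fun e : Edge 4 (M + 1) => α e.1 e.2) β
  have h1 := wilsonExpectation_sum_mul_re β M
    (fun q : Plaquette 4 (M + 1) => rplaqCharge (fun e : Edge 4 (M + 1) => α e.1 e.2) q.1 q.2.1.1 q.2.1.2 ^ 2)
  rw [h1] at h
  have hsq : (fun U : GaugeConfig 4 (M + 1) Circle =>
      (∑ p : Plaquette 4 (M + 1), LatticeForm.res (LatticeForm.td₁ α) p *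
          ((plaquetteHolonomy U p.1 p.2.1.1 p.2.1.2 : Circle) : ℂ).im) ^ 2) =
      fun U => ractionFlowDeriv (fun e : Edge 4 (M + 1) => α e.1 e.2) U *
        ractionFlowDeriv (fun e : Edge 4 (M + 1) => α e.1 e.2) U := by
    funext U
    rw [sq, ractionFlowDeriv_cochain]
  rw [hsq, ← h, mul_comm]
  rfl

/-- **Zero covariance with the transverse sector**: `β⟨f_u·f_(dα)⟩ = 0` for `u ⟂ dδ_e` (all `e`). [cite: FrohlichSpencer1982, §2] -/
theorem cross_sector (β : ℝ) (M : ℕ) (α : Site 4 (M + 1) → Fin 4 → ℝ) {u : Plaquette 4 (M + 1) → ℝ}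
    (hu : ∀ e : Edge 4 (M + 1), ∑ p : Plaquette 4 (M + 1), u p *
      LatticeForm.res (LatticeForm.td₁ (fun (y : Site 4 (M + 1)) (k : Fin 4) => if y = e.1 ∧ k = e.2 then (1 : ℝ) else 0)) p = 0) :
    β * wilsonExpectation (L := M + 1) u1Rep β (fun U : GaugeConfig 4 (M + 1) Circle =>
        (∑ p : Plaquette 4 (M + 1), u p * ((plaquetteHolonomy U p.1 p.2.1.1 p.2.1.2 : Circle) : ℂ).im) *
          ∑ p : Plaquette 4 (M + 1), LatticeForm.res (LatticeForm.td₁ α) p *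
            ((plaquetteHolonomy U p.1 p.2.1.1 p.2.1.2 : Circle) : ℂ).im) = 0 := by
  set c : Edge 4 (M + 1) → ℝ := fun e => α e.1 e.2 with hc
  have hward := u1_torus_ward_identity_real (d := 4) (L := M + 1) c β
    (F := fun U : GaugeConfig 4 (M + 1) Circle =>
      ∑ p : Plaquette 4 (M + 1), u p * ((plaquetteHolonomy U p.1 p.2.1.1 p.2.1.2 : Circle) : ℂ).im)
    (XF := fun U : GaugeConfig 4 (M + 1) Circle =>
      ∑ p : Plaquette 4 (M + 1), (u p * rplaqCharge c p.1 p.2.1.1 p.2.1.2) *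
        ((plaquetteHolonomy U p.1 p.2.1.1 p.2.1.2 : Circle) : ℂ).re)
    (continuous_finsetSum _ fun p _ => continuous_const.mul (continuous_plaquette_im _ _ _))
    (continuous_finsetSum _ fun p _ => continuous_const.mul (continuous_plaquette_re _ _ _))
    (fun U t => by
      simp only [plaquetteHolonomy_rphaseFlow]
      refine HasDerivAt.fun_sum fun q _ => ?_
      have h := (hasDerivAt_coe_exp_mul_im (rplaqCharge c q.1 q.2.1.1 q.2.1.2)
        (plaquetteHolonomy U q.1 q.2.1.1 q.2.1.2) t).const_mul (u q)
      refine h.congr_deriv ?_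
      ring)
  rw [wilsonExpectation_sum_mul_re] at hward
  have hzero : ∑ q : Plaquette 4 (M + 1), u q * rplaqCharge c q.1 q.2.1.1 q.2.1.2 = 0 :=
    sum_mul_res_td₁_eq_zero hu α
  rw [hzero, zero_mul] at hward
  rw [show (fun U : GaugeConfig 4 (M + 1) Circle =>
        (∑ p : Plaquette 4 (M + 1), u p * ((plaquetteHolonomy U p.1 p.2.1.1 p.2.1.2 : Circle) : ℂ).im) *
          ∑ p : Plaquette 4 (M + 1), LatticeForm.res (LatticeForm.td₁ α) p *
            ((plaquetteHolonomy U p.1 p.2.1.1 p.2.1.2 : Circle) : ℂ).im) =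
      fun U => (∑ p : Plaquette 4 (M + 1), u p * ((plaquetteHolonomy U p.1 p.2.1.1 p.2.1.2 : Circle) : ℂ).im) *
        ractionFlowDeriv c U from funext fun U => by rw [ractionFlowDeriv_cochain]]
  exact hward.symm

/-! ## §4 The Ward lever -/

/-- **`WardPinning`** (item stmt-QuantumFields-22930), BY NAME: for `β > 0`, all `M`, every real 1-cochain `α` and every `u`
orthogonal to all `dδ_e`, `β·⟨f_(dα+u)²⟩ = torusMeanPlaq(β,M)·|dα|² + β·⟨f_u²⟩`. [cite: Guth1980, §III] -/
theorem wardPinning_proof : Summit.QuantumFields.YangMills.Theses.TransverseWardBL.WardPinning := by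
  unfold Summit.QuantumFields.YangMills.Theses.TransverseWardBL.WardPinning
  intro β _hβ M α u hu
  simp only
  -- names for the three observables
  set fa : GaugeConfig 4 (M + 1) Circle → ℝ := fun U =>
    ∑ p : Plaquette 4 (M + 1), LatticeForm.res (LatticeForm.td₁ α) p *
      ((plaquetteHolonomy U p.1 p.2.1.1 p.2.1.2 : Circle) : ℂ).im with hfa
  set fu : GaugeConfig 4 (M + 1) Circle → ℝ := fun U =>
    ∑ p : Plaquette 4 (M + 1), u p * ((plaquetteHolonomy U p.1 p.2.1.1 p.2.1.2 : Circle) : ℂ).im with hfu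
  have hfa_c : Continuous fa := continuous_finsetSum _ fun p _ => continuous_const.mul (continuous_plaquette_im _ _ _)
  have hfu_c : Continuous fu := continuous_finsetSum _ fun p _ => continuous_const.mul (continuous_plaquette_im _ _ _)
  -- pointwise expansion of the square
  have hpt : (fun U : GaugeConfig 4 (M + 1) Circle =>
      (∑ p : Plaquette 4 (M + 1), (LatticeForm.res (LatticeForm.td₁ α) p + u p) *
        ((plaquetteHolonomy U p.1 p.2.1.1 p.2.1.2 : Circle) : ℂ).im) ^ 2) =
      fun U => fa U ^ 2 + 2 * (fu U * fa U) + fu U ^ 2 := by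
    funext U
    have hsum : ∑ p : Plaquette 4 (M + 1), (LatticeForm.res (LatticeForm.td₁ α) p + u p) *
        ((plaquetteHolonomy U p.1 p.2.1.1 p.2.1.2 : Circle) : ℂ).im = fa U + fu U := by
      simp only [hfa, hfu, add_mul, Finset.sum_add_distrib]
    rw [hsum]; ring
  have hexp : wilsonExpectation (L := M + 1) u1Rep β (fun U : GaugeConfig 4 (M + 1) Circle =>
      (∑ p : Plaquette 4 (M + 1), (LatticeForm.res (LatticeForm.td₁ α) p + u p) *
        ((plaquetteHolonomy U p.1 p.2.1.1 p.2.1.2 : Circle) : ℂ).im) ^ 2) =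
      wilsonExpectation (L := M + 1) u1Rep β (fun U => fa U ^ 2) +
        2 * wilsonExpectation (L := M + 1) u1Rep β (fun U => fu U * fa U) +
        wilsonExpectation (L := M + 1) u1Rep β (fun U => fu U ^ 2) := by
    rw [hpt]
    unfold wilsonExpectation
    have i1 : Integrable (fun U => fa U ^ 2) (wilsonMeasure (L := M + 1) u1Rep β) :=
      integrable_wilson_of_continuous β (hfa_c.pow 2)
    have i2 : Integrable (fun U => 2 * (fu U * fa U)) (wilsonMeasure (L := M + 1) u1Rep β) :=
      integrable_wilson_of_continuous β (continuous_const.mul (hfu_c.mul hfa_c))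
    have i3 : Integrable (fun U => fu U ^ 2) (wilsonMeasure (L := M + 1) u1Rep β) :=
      integrable_wilson_of_continuous β (hfu_c.pow 2)
    have i12 : Integrable (fun U => fa U ^ 2 + 2 * (fu U * fa U)) (wilsonMeasure (L := M + 1) u1Rep β) := i1.add i2
    simp only
    rw [integral_add i12 i3, integral_add i1 i2, integral_const_mul]
  have hA := exact_sector β M α
  have hC := cross_sector β M α hu
  rw [hexp]
  linear_combination hA + 2 * hC

end Summit.QuantumFields.YangMills.Theorems.TransverseWardBL

end
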